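import Mathlib
import HarnessLib
import Summits.ValiantsHypothesis.ValiantsHypothesis.Theses.MonotoneRestoration
import Literature.Computability.AlgebraicComplexity.ArithCircuit
import Literature.Computability.AlgebraicComplexity.ArithCircuitProofs
import Literature.Computability.AlgebraicComplexity.MonotoneStructure
import Literature.Computability.AlgebraicComplexity.PermanentIrreducible
import Literature.ModelTheory.FiniteModelTheory.CkEquiv
import Summits.ValiantsHypothesis.ValiantsHypothesis.Theorems.MonotoneRestorationMonotoneRestorationQPCosetCount
import Summits.ValiantsHypothesis.ValiantsHypothesis.Theorems.MonotoneRestorationMonotoneRestorationQPSymmetricLB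
import Summits.ValiantsHypothesis.ValiantsHypothesis.Theorems.MonotoneRestorationMonotoneRestorationQPSupportSymmetrisation
import Summits.ValiantsHypothesis.ValiantsHypothesis.Theorems.MonotoneRestorationMonotoneRestorationQPSparseRegime
import Summits.ValiantsHypothesis.ValiantsHypothesis.Theorems.MonotoneRestorationMonotoneRestorationQPBeta
import Literature.Computability.AlgebraicComplexity.SymmetricArithCircuit
import Literature.Computability.AlgebraicComplexity.DawarWilsenach2025Proofs
import Literature.GroupTheory.PermutationGroups.SmallIndexSubgroups
import Summits.ValiantsHypothesis.ValiantsHypothesis.Theorems.MonotoneRestorationQP.Negative.LoadBearing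
import Summits.ValiantsHypothesis.ValiantsHypothesis.Theorems.MonotoneRestorationMonotoneRestorationQPPermSupportCount

/-! TTRL-lite variant V19901 of stmt-ValiantsHypothesis-15886 -/

-- `Summit.ValiantsHypothesis.ValiantsHypothesis.…` is the tree's mandated single-conjunct layout
-- (Sub = Summit), so the duplicated namespace component is intended.
set_option linter.dupNamespace false

namespace Summit.ValiantsHypothesis.ValiantsHypothesis.Theorems

open Summit.ValiantsHypothesis.ValiantsHypothesis.Theses.MonotoneRestoration
open Literature.Computability.AlgebraicComplexity

/-- **TTRL-lite variant V19901** (`strengthen_hyp`) of `stub_monotoneComputation_of_complexity`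
(item `stmt-ValiantsHypothesis-15886`) is **false**: one cannot ask the Jerrum–Snir monotone
computation of size `≤ 3 · complexity` to be, in addition, *constant-free* (`HasSignConstants`:
all constants and coefficients in `{0, 1, -1}`, i.e. `{0, 1}` over `ℝ≥0`), not even for
polynomials with natural-number coefficients. Witness: `σ := Unit`, `q := C 4`. Constants are
free (`complexity_C_holds`), so `complexity (C 4) = 0` forces a gate-free circuit, whose value is
a leaf — a variable `X i`, a sign constant `C 0` / `C 1`, or the junk value `0` of a dangling gate
reference — and none of these is `C 4` (compare constant coefficients).
[cite: Burgisser2000, Def. 2.1 and §1.4] [cite: JerrumSnir1982, §2.2] -/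
theorem stub_monotoneComputation_of_complexity_var19901_false :
    ¬ (∀ (σ : Type) (q : MvPolynomial σ ℕ), ∃ P : ArithCircuit NNReal σ,
      Literature.Barriers.ValiantsHypothesis.IsMonotoneComputation P
          (MvPolynomial.map (Nat.castRingHom NNReal) q) ∧
        P.HasSignConstants ∧
        P.size ≤ 3 * complexity (MvPolynomial.map (Nat.castRingHom NNReal) q)) := by
  intro h
  obtain ⟨P, ⟨-, -, hcomp⟩, ⟨-, hout⟩, hsize⟩ := h Unit (MvPolynomial.C 4)
  have hmap : MvPolynomial.map (Nat.castRingHom NNReal) (MvPolynomial.C 4 : MvPolynomial Unit ℕ)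
      = MvPolynomial.C (4 : NNReal) := by
    rw [MvPolynomial.map_C, map_ofNat]
  rw [hmap] at hcomp hsize
  rw [complexity_C_holds, mul_zero, Nat.le_zero] at hsize
  have hc : P.eval = MvPolynomial.C (4 : NNReal) := hcomp
  have hg : P.gates = [] := List.length_eq_zero_iff.mp hsize
  obtain ⟨gates, output⟩ := P
  subst hg
  have key := congrArg MvPolynomial.constantCoeff hc
  cases output with
  | var i =>
    simp [ArithCircuit.eval, ArithCircuit.Operand.eval] at key
  | const c =>
    simp only [ArithCircuit.eval, ArithCircuit.Operand.eval, MvPolynomial.constantCoeff_C] at key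
    subst key
    simp only [ArithCircuit.Operand.HasSignConstants, ArithCircuit.IsSignConstant] at hout
    rcases hout with h0 | h1 | h2
    · norm_num at h0
    · norm_num at h1
    · exact absurd h2 (by positivity)
  | gate j =>
    simp [ArithCircuit.eval, ArithCircuit.Operand.eval, ArithCircuit.gateValues] at key

end Summit.ValiantsHypothesis.ValiantsHypothesis.Theorems
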